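import Literature.NumberTheory.LFunctions.GrossencharakterWeightOneNorm
import HarnessLib

/-!
# The Größencharakter of an algebraic Hecke character (`IsGrossencharakter` from `HasInfinityType`), and
# the type-`(1,0)` ray relation `φ((α)) = α` over an imaginary quadratic field

Topic `NumberTheory/GaloisRepresentations`; namespace `Literature.NumberTheory.GaloisRepresentations.HeckeCharacter`.
Proof file (theorems only; no definition, no named fact, no instance). Adapter between the IDELIC
currency of the tree's `HeckeCharacter` (`HasInfinityType`, module of definition `IsModulus χ T e`,
`modulusIdeal T e`) and the IDEAL currency of `LFunctions/RayClassesColonIdeal.lean`,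
`EllipticCurves/EisensteinNumbersPartialHeckeL.lean`, `…/EisensteinKroneckerNumbersPartialHeckeL.lean`,
`…/EisensteinKroneckerNumbersClassSum.lean`, `LFunctions/GrossencharakterWeightOneNorm.lean` (their hypothesis
"`ψ̃ = idealPow K ψ` of type `ιK` on the ray mod `𝔪`": `ψ̃((b))·ιK c = ψ̃((c))·ιK b` for nonzero `b ≡ c mod 𝔪`,
`c` prime to `𝔪` — de Shalit's `φ((α)) = α`, II.1.1 / II.1.4 (12)):

* `HasInfinityType.isGrossencharakter_valueAtUniformizer` — an algebraic Hecke character with module of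
  definition `(T, e)` gives the Größencharakter `v ↦ χ(ϖ_v)` mod `𝔪(T, e)` of the same infinity type
  (`IsGrossencharakter`; this is `HasInfinityType.idealPow_span_eq` repackaged — Neukirch VII (6.13)–(6.14));
* `prod_embedding_zpow_one_zero` / `prod_embedding_zpow_zero_one` — over an imaginary quadratic field the
  archimedean monomial of type `(1, 0)` resp. `(0, 1)` IS the embedding `w₀.embedding` resp. its conjugate;
* ★ `HasInfinityType.idealPow_span_mul_embedding_eq` / `…_conj_embedding_eq` — for `χ` of infinity type
  `(1, 0)` resp. `(0, 1)` over an imaginary quadratic `K` with module of definition `(T, e)`: the type-`ιK` ray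
  relation for `ψ := χ(ϖ_·)`, `𝔪 := modulusIdeal T e`, `ιK := w₀.embedding` resp. `conj ∘ w₀.embedding` —
  the `hψ` of all the Eisenstein-number-versus-`L`-series theorems of the cell's complex side.

References: J. Neukirch, *Algebraic Number Theory* (1999), Ch. VII §6 Prop. (6.13), Cor. (6.14)
[NeukirchANT1999]; E. de Shalit (1987), II.1.1, II.1.4 (12) (p. 32–37) [deShalit1987]; A. Weil (1956) [Weil1956].

Mathlib / tree search: tree `HasInfinityType.idealPow_span_eq`, `valueAtUniformizer_ne_zero'`,
`IsGrossencharakter`, `LFunctions.idealPow_span_mul_eq_of_isGrossencharakter`,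
`LFunctions.subsingleton_infinitePlace_of_finrank_eq_two`; Mathlib `Fintype.prod_subsingleton`,
`IsTotallyComplex.complexEmbedding_not_isReal` (`lean search 'isGrossencharakter_valueAtUniformizer|HasInfinityType.isGrossencharakter'` — nothing).
-/

noncomputable section

open scoped ComplexConjugate
open NumberField NumberField.InfinitePlace IsDedekindDomain
open Literature.NumberTheory.LFunctions

namespace Literature.NumberTheory.GaloisRepresentations

namespace HeckeCharacter

variable {K : Type} [Field K] [NumberField K]

/-! ### §1. `IsGrossencharakter` from `HasInfinityType` -/

/-- **The Größencharakter of an algebraic Hecke character**: if `χ` has infinity type `(p, q)` and module of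
definition `(T, e)`, then `v ↦ χ(ϖ_v)` is an `IsGrossencharakter` modulo `𝔪(T, e)` of type `(p, q)` (nonzero
values; the infinity type on the ray is `HasInfinityType.idealPow_span_eq`).
[cite: NeukirchANT1999, Ch. VII §6 Prop. (6.13) and Cor. (6.14)] -/
theorem HasInfinityType.isGrossencharakter_valueAtUniformizer {χ : HeckeCharacter K}
    {p q : InfinitePlace K → ℤ} {T : Finset (HeightOneSpectrum (𝓞 K))} {e : HeightOneSpectrum (𝓞 K) → ℕ}
    (hinf : χ.HasInfinityType p q) (hmod : IsModulus χ T e) :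
    IsGrossencharakter (modulusIdeal T e) p q (fun v ↦ χ.valueAtUniformizer v) :=
  ⟨fun v _ ↦ valueAtUniformizer_ne_zero' χ v,
    fun _ _ hb hc hcop hbc hpos ↦ hinf.idealPow_span_eq hmod hb hc hcop hbc hpos⟩

/-! ### §2. Imaginary quadratic fields: the archimedean monomials of type `(1,0)` and `(0,1)` -/

omit [NumberField K] in
/-- A totally complex field has no ring homomorphism to `ℝ` (so the total-positivity conditions of the ray
relations are void). [cite: NeukirchANT1999, Ch. III §1] -/
private theorem false_of_ringHom_real' [IsTotallyComplex K] (τ : K →+* ℝ) : False := by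
  refine IsTotallyComplex.complexEmbedding_not_isReal (Complex.ofRealHom.comp τ) ?_
  rw [ComplexEmbedding.isReal_iff]
  ext x
  simp [ComplexEmbedding.conjugate_coe_eq]

/-- Over an imaginary quadratic field the type-`(1, 0)` monomial `∏_w σ_w(a)^1 σ̄_w(a)^0` is `σ_{w₀}(a)` for the
(unique) infinite place `w₀`. [cite: NeukirchANT1999, Ch. VII §6 (6.13)] -/
theorem prod_embedding_zpow_one_zero [IsTotallyComplex K] (h2 : Module.finrank ℚ K = 2)
    (w₀ : InfinitePlace K) (a : K) :
    ∏ w : InfinitePlace K, w.embedding a ^ ((fun _ ↦ (1 : ℤ)) w) * conj (w.embedding a) ^ ((fun _ ↦ (0 : ℤ)) w) =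
      w₀.embedding a := by
  haveI := subsingleton_infinitePlace_of_finrank_eq_two (K := K) h2
  rw [Fintype.prod_subsingleton _ w₀]
  simp

/-- Over an imaginary quadratic field the type-`(0, 1)` monomial is the CONJUGATE embedding `conj ∘ σ_{w₀}`.
[cite: NeukirchANT1999, Ch. VII §6 (6.13)] -/
theorem prod_embedding_zpow_zero_one [IsTotallyComplex K] (h2 : Module.finrank ℚ K = 2)
    (w₀ : InfinitePlace K) (a : K) :
    ∏ w : InfinitePlace K, w.embedding a ^ ((fun _ ↦ (0 : ℤ)) w) * conj (w.embedding a) ^ ((fun _ ↦ (1 : ℤ)) w) =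
      ((starRingEnd ℂ).comp w₀.embedding) a := by
  haveI := subsingleton_infinitePlace_of_finrank_eq_two (K := K) h2
  rw [Fintype.prod_subsingleton _ w₀]
  simp

/-! ### §3. The type-`ιK` ray relation `φ((α)) = α` for characters of type `(1,0)` / `(0,1)` -/

/-- ★ **`φ((b))·σ(c) = φ((c))·σ(b)` for `b ≡ c mod 𝔪`** — de Shalit's `φ((α)) = α` (II.1.4 (12)) — for a Hecke
character `φ` of an imaginary quadratic field of infinity type `(1, 0)` with module of definition `(T, e)`,
`𝔪 = modulusIdeal T e`, `σ = w₀.embedding`: this is the hypothesis `hψ` of the tree's Eisenstein-number /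
partial-`L`-series identities (`PeriodPair.eisensteinE_eq_tsum_rayClass`, …) for `ψ := φ(ϖ_·)`.
[cite: deShalit1987, II.1.4 (12) (p. 35)] [cite: NeukirchANT1999, Ch. VII §6 Prop. (6.13)] -/
theorem HasInfinityType.idealPow_span_mul_embedding_eq [IsTotallyComplex K] (h2 : Module.finrank ℚ K = 2)
    (w₀ : InfinitePlace K) {χ : HeckeCharacter K} {T : Finset (HeightOneSpectrum (𝓞 K))}
    {e : HeightOneSpectrum (𝓞 K) → ℕ} (hinf : χ.HasInfinityType (fun _ ↦ 1) (fun _ ↦ 0))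
    (hmod : IsModulus χ T e) (b c : 𝓞 K) (hb : b ≠ 0) (hc : c ≠ 0)
    (hcop : IsCoprime (Ideal.span {c}) (modulusIdeal T e)) (hbc : b - c ∈ modulusIdeal T e) :
    idealPow K (fun v ↦ χ.valueAtUniformizer v) (Ideal.span {b}) * w₀.embedding c =
      idealPow K (fun v ↦ χ.valueAtUniformizer v) (Ideal.span {c}) * w₀.embedding b :=
  idealPow_span_mul_eq_of_isGrossencharakter w₀.embedding (hinf.isGrossencharakter_valueAtUniformizer hmod)
    (fun a _ ↦ prod_embedding_zpow_one_zero h2 w₀ a) b c hb hc hcop hbc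
    fun τ ↦ (false_of_ringHom_real' τ).elim

/-- ★ The same for infinity type `(0, 1)`, with `σ = conj ∘ w₀.embedding` (the other complex embedding).
[cite: deShalit1987, II.1.4 (12) (p. 35)] [cite: NeukirchANT1999, Ch. VII §6 Prop. (6.13)] -/
theorem HasInfinityType.idealPow_span_mul_conj_embedding_eq [IsTotallyComplex K] (h2 : Module.finrank ℚ K = 2)
    (w₀ : InfinitePlace K) {χ : HeckeCharacter K} {T : Finset (HeightOneSpectrum (𝓞 K))}
    {e : HeightOneSpectrum (𝓞 K) → ℕ} (hinf : χ.HasInfinityType (fun _ ↦ 0) (fun _ ↦ 1))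
    (hmod : IsModulus χ T e) (b c : 𝓞 K) (hb : b ≠ 0) (hc : c ≠ 0)
    (hcop : IsCoprime (Ideal.span {c}) (modulusIdeal T e)) (hbc : b - c ∈ modulusIdeal T e) :
    idealPow K (fun v ↦ χ.valueAtUniformizer v) (Ideal.span {b}) * ((starRingEnd ℂ).comp w₀.embedding) c =
      idealPow K (fun v ↦ χ.valueAtUniformizer v) (Ideal.span {c}) * ((starRingEnd ℂ).comp w₀.embedding) b :=
  idealPow_span_mul_eq_of_isGrossencharakter ((starRingEnd ℂ).comp w₀.embedding)
    (hinf.isGrossencharakter_valueAtUniformizer hmod)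
    (fun a _ ↦ prod_embedding_zpow_zero_one h2 w₀ a) b c hb hc hcop hbc
    fun τ ↦ (false_of_ringHom_real' τ).elim

/-- **Nonvanishing off the modulus** (the hypothesis `hψ0` of the same theorems) is automatic for
`ψ := χ(ϖ_·)`: the values at uniformizers are units. [cite: NeukirchANT1999, Ch. VII §6 Prop. (6.13)] -/
theorem valueAtUniformizer_ne_zero_of_not_le (χ : HeckeCharacter K) (𝔪 : Ideal (𝓞 K)) :
    ∀ v : HeightOneSpectrum (𝓞 K), ¬ 𝔪 ≤ v.asIdeal → χ.valueAtUniformizer v ≠ 0 :=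
  fun v _ ↦ valueAtUniformizer_ne_zero' χ v

end HeckeCharacter

end Literature.NumberTheory.GaloisRepresentations

end
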